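import Summits.SmoothPoincare4.SmoothPoincare4.Theses.EntropyRung
import Summits.SmoothPoincare4.SmoothPoincare4.Theorems.ConicalGap.Negative.DecayClause
import Literature.Geometry.Riemannian.RoundCylinderFourVolume

/-!
# Tightness is LOST on the conical class (negative lemmas for crux stmt-SmoothPoincare4-16589, `ConicalGap`)

`EntropyRung.ConicalGap` keeps the constant `32π²√π e^{-3/2} = (4π)²·Θ(S³×ℝ)` of its parent `NoncompactShrinkerGap`
while restricting to shrinkers whose scalar curvature decays at infinity. Kernel-checked here:

* `conicalGap_excludedExtremiser` — there is a model meeting EVERY hypothesis of the parent crux and attaining the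
  constant EXACTLY (the round cylinder `S³(2)×ℝ` on `ℝ⁴∖0`, `f = (log|y|)² + 3/2`, `∫e^{-f}dV = 32π²√πe^{-3/2}`:
  `Literature/Geometry/Riemannian/RoundCylinderFour*.lean`), and that model VIOLATES the decay clause (`R ≡ 3/2`,
  `conicalGap_roundCylinderFour_not_decayClause`). It is the only extremiser known (Li–Wang 2024: `S³×ℝ` is even
  PGH-rigid among shrinkers), so on the conical class the constant is not known to be sharp, and the strict variant
  `<` of `ConicalGap` is refuted by nothing in the tree or in print.
* `conicalGap_fikDensity_lt_thetaCyl` — the best known member of the class, the Feldman–Ilmanen–Knopf shrinker on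
  `O(−1) → ℂP¹` (the ONLY complete non-flat asymptotically conical 4-d gradient shrinker in print), has density
  `Θ(FIK) = e^{√2−2}(1+√2)/2 = .672` in closed form (Calabi ansatz with `μ = √2`: `Θ = e^{2(μ−1)}e^{−μ}(1/μ + 1/μ²)`;
  CHI 2004 §4 table: `.672`; re-derived in the disprover's `compute/calabi_family.py`); the lemma is the arithmetic
  `e^{√2−2}(1+√2)/2 < 2√πe^{-3/2} = Θ(S³×ℝ) = .791`: granted the closed form, FIK obeys the crux with a 15 % margin,
  and NO known datum of the class comes closer. (So "`Θ ≤ 2/e`" or even "`Θ ≤ Θ(FIK)`" on the conical class are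
  unrefuted strengthenings — slack a prover may try to use, and the reason a refuter has no sharpness witness.)

Refuter negative lemmas (cdisprove cycle 1), `--supports stmt-SmoothPoincare4-16589`; nothing here asserts a Theses decl.
-/

noncomputable section

set_option linter.dupNamespace false

namespace Summit.SmoothPoincare4.SmoothPoincare4.Theorems.ConicalGap.Negative

open scoped Manifold ContDiff ENNReal NNReal
open MeasureTheory Set
open Literature.Geometry.Riemannian Literature.Geometry.Lorentzian
open Literature.Geometry.Lorentzian.PseudoRiemannianMetric

/-- **The parent's extremiser is outside the conical class**: some datum satisfies every hypothesis of
`NoncompactShrinkerGap`, attains `∫ e^{-f} dV = 32π²√πe^{-3/2}` exactly, and violates the decay clause of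
`ConicalGap` — the round cylinder `S³(2)×ℝ` (`R ≡ 3/2`). [cite: CaoHamiltonIlmanen2004, §4] -/
theorem conicalGap_excludedExtremiser :
    ∃ (M : Type) (_ : TopologicalSpace M) (_ : T2Space M) (_ : SecondCountableTopology M)
      (_ : ChartedSpace (EuclideanSpace ℝ (Fin 4)) M) (_ : IsManifold (𝓡 4) ∞ M)
      (_ : ConnectedSpace M) (_ : NoncompactSpace M) (_ : T3Space M) (_ : MeasurableSpace M)
      (_ : BorelSpace M)
      (g : PseudoRiemannianMetric (𝓡 4) ∞ (EuclideanSpace ℝ (Fin 4)) (TangentSpace (𝓡 4) : M → Type _))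
      (_ : g.HasLeviCivita) (f : M → ℝ) (hg : g.IsRiemannian),
      (∀ (x : M) (r : NNReal), IsCompact {y : M | g.edist hg x y ≤ r}) ∧
      ContMDiff (𝓡 4) 𝓘(ℝ, ℝ) ∞ f ∧
      (∀ (x : M) (X Y : TangentSpace (𝓡 4) x),
        g.ricci x X Y + g.hessian f x X Y = (1 / 2 : ℝ) * g.val x X Y) ∧
      (∀ x : M, g.scalarCurvature x + g.gradSq f x = f x) ∧
      (∃ x : M, g.scalarCurvature x ≠ 0) ∧
      ∫⁻ x, ENNReal.ofReal (Real.exp (-f x))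
          ∂(riemannianMeasure (g.toContMDiffRiemannianMetric hg)) =
        ENNReal.ofReal (32 * Real.pi ^ 2 * Real.sqrt Real.pi * Real.exp (-(3 : ℝ) / 2)) ∧
      ¬ (∀ ε : ℝ, 0 < ε → ∃ K : Set M, IsCompact K ∧ ∀ x, x ∉ K → g.scalarCurvature x < ε) := by
  have hpt : RoundCylinderFour.P4 := ⟨EuclideanSpace.single 0 1, by
    change EuclideanSpace.single (0 : Fin 4) (1 : ℝ) ∈ ({(0 : EuclideanFour)}ᶜ : Set EuclideanFour)
    simp⟩
  exact ⟨RoundCylinderFour.P4, inferInstance, inferInstance, inferInstance, inferInstance,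
    inferInstance, inferInstance, inferInstance, inferInstance, inferInstance, inferInstance,
    RoundCylinderFour.cylP, inferInstance, RoundCylinderFour.fP, RoundCylinderFour.isRiemannian_cylP,
    RoundCylinderFour.isCompact_setOf_edist_le, RoundCylinderFour.contMDiff_fP,
    RoundCylinderFour.soliton, RoundCylinderFour.normalisation,
    ⟨hpt, RoundCylinderFour.scalarCurvature_ne_zero hpt⟩, RoundCylinderFour.lintegral_exp_neg_fP,
    conicalGap_roundCylinderFour_not_decayClause⟩

/-- **Checked arithmetic for the best known member of the class**: `Θ(FIK) = e^{√2−2}(1+√2)/2 < 2√πe^{-3/2} =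
Θ(S³×ℝ)` (`.672 < .791`). Proof: `√2 < 1.4143`, `e^{√2−1/2} < e`, `e < 2.7182818286`, `1.7724 < √π`.
[cite: CaoHamiltonIlmanen2004, §4] [cite: FeldmanIlmanenKnopf2003, Thm 1.2] -/
theorem conicalGap_fikDensity_lt_thetaCyl :
    Real.exp (Real.sqrt 2 - 2) * (1 + Real.sqrt 2) / 2 < 2 * Real.sqrt Real.pi * Real.exp (-(3 : ℝ) / 2) := by
  have h2 : Real.sqrt 2 < 1.4143 := (Real.sqrt_lt' (by norm_num)).mpr (by norm_num)
  have hπ : (1.7724 : ℝ) < Real.sqrt Real.pi :=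
    (Real.lt_sqrt (by norm_num)).mpr (by nlinarith [Real.pi_gt_d6])
  have hexp : Real.exp (Real.sqrt 2 - 2) < Real.exp 1 * Real.exp (-(3 : ℝ) / 2) := by
    rw [← Real.exp_add]
    exact Real.exp_lt_exp.mpr (by linarith)
  have he1 : Real.exp 1 < 2.7182818286 := Real.exp_one_lt_d9
  have hE : 0 < Real.exp (-(3 : ℝ) / 2) := Real.exp_pos _
  calc Real.exp (Real.sqrt 2 - 2) * (1 + Real.sqrt 2) / 2
      < Real.exp 1 * Real.exp (-(3 : ℝ) / 2) * (1 + Real.sqrt 2) / 2 := by gcongr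
    _ ≤ 2.7182818286 * Real.exp (-(3 : ℝ) / 2) * 2.4143 / 2 := by gcongr; linarith
    _ < 2 * 1.7724 * Real.exp (-(3 : ℝ) / 2) := by nlinarith
    _ ≤ 2 * Real.sqrt Real.pi * Real.exp (-(3 : ℝ) / 2) := by gcongr

end Summit.SmoothPoincare4.SmoothPoincare4.Theorems.ConicalGap.Negative

end
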